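import Summits.QuantumFields.QCD.Theorems.SpectralDefectExtinctionWegnerEstimateBallSampling

/-!
# Bridge toward the rigidity stubs of line `Sketch` (skeleton "ResolventCell", gen 2b/2c) for crux
`SpectralDefectExtinction.WegnerEstimate` (item stmt-QuantumFields-8966): pulled-back ball and port fields

Companion of `…WegnerEstimateBallSampling` (row formula of `Γ₅ D_W`; sampling and current identities for a general
zero-extended field on `ℤ⁴`), instantiated for the two zero-extended restrictions of the pull-back
`y ↦ ψ(x + proj y)` used by the landed `…SketchDefs`, plus the local-mass inequality:
* `ballSampling_boxMass_image_le` — `boxMass ψ {x + proj y : y ∈ S} ≤ Σ_{y ∈ S, a, α} ‖ψ(x + proj y, a, α)‖²` for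
  any finite `S ⊆ ℤ⁴` (sum over PREIMAGES, no injectivity of `y ↦ x + proj y`), and this sum is the squared norm of
  the pull-back to `S` (`ballSampling_sum_subtype_pullback`);
* BALL field on `box 4 (R+1)` (gen 2b: `ballVal`/`ballApply`/`ballCurrent`/`ballNormSq`): `ballApply = Γ₅ D_W ψ`
  sampled on `box 4 R` (`ballSampling_ballApply_pullback(_of_mem_box)`), zero cube residual of a pulled-back
  eigenvector (`ballSampling_residual_pullback_eq_zero`), `ballCurrent` = the registered current summand or `0`
  (`ballSampling_ballCurrent_pullback`, `…_eq_zero`, `ballSampling_abs_ballCurrent_pullback_le`), and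
  `boxMass (image of box R') ≤ ballNormSq` for `R' ≤ R + 1` (`ballSampling_boxMass_le_ballNormSq`);
* PORT field on `portDomain R` (gen 2c: `portVal`/`latticeApply`/`latticeCurrent`/`portNormSq`): for `R ≥ 1` the
  interior cube `box 4 (R − 1)` and its neighbours lie in the port domain, so `latticeApply = Γ₅ D_W ψ` there
  (`ballSampling_latticeApply_portVal_pullback`) and the interior residual of a pulled-back eigenvector vanishes,
  for every `R` (`ballSampling_portInteriorResSq_pullback_eq_zero`; `portDomain 0 = ∅`); the cube current sum with
  the glued links is at most the registered right-hand side VERBATIM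
  (`ballSampling_portCurrentSum_pullback_le_verbatim`); `boxMass (image of box (R − 1)) ≤ portNormSq`
  (`ballSampling_boxMass_le_portNormSq`).
The face residual (port projection of the one cut-off outward hop) is not treated here; its input is the defect
identity `ballSampling_latticeApply_read_sub` of the companion file.  No new definitions.  USAGE: pass the glued
configuration `W := fun e => if … then V e else U e` EXPLICITLY (a `_` solved against an expected type containing the
glue β-redex `?W (x + proj l.1, l.2) =?= (fun e => …) (…)` makes the unifier time out); `exact` then closes the
registered shapes by β-reduction (checked).
-/

noncomputable section

namespace Summit.QuantumFields.QCD.Cruxes.WegnerEstimate.ResolventCell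

open scoped Matrix BigOperators
open Literature.MathematicalPhysics.QuantumLattice Literature.MathematicalPhysics.QuantumFieldTheory
  Literature.Probability.LatticeModels
open Matrix

/-! ### Local mass versus the pull-back norm -/

/-- The local mass as a site sum: `boxMass ψ B = Σ_{z ∈ B} Σ_{a, α} ‖ψ(z, a, α)‖²`. -/
theorem ballSampling_boxMass_eq_sum {L : ℕ} [NeZero L] (ψ : QuarkIdx L → ℂ) (B : Finset (TorusSite 4 L)) :
    boxMass ψ B = ∑ z ∈ B, ∑ a : Fin 3, ∑ α : Fin 4, ‖ψ (z, a, α)‖ ^ 2 := by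
  rw [boxMass, Finset.sum_filter, Fintype.sum_prod_type]
  simp only [Fintype.sum_prod_type]
  have h : ∀ z : TorusSite 4 L, (∑ a : Fin 3, ∑ α : Fin 4, if z ∈ B then ‖ψ (z, a, α)‖ ^ 2 else 0) =
      if z ∈ B then ∑ a : Fin 3, ∑ α : Fin 4, ‖ψ (z, a, α)‖ ^ 2 else 0 := fun z => by split_ifs <;> simp
  simp only [h]
  rw [Finset.sum_ite_mem, Finset.univ_inter]

/-- **Local mass is at most the sum over preimages.**  For any finite `S ⊆ ℤ⁴`,
`boxMass ψ {x + proj y : y ∈ S} ≤ Σ_{y ∈ S} Σ_{a, α} ‖ψ(x + proj y, a, α)‖²` — no injectivity of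
`y ↦ x + proj y` on `S` is needed (every site of the image has at least one preimage and the terms are `≥ 0`). -/
theorem ballSampling_boxMass_image_le {L : ℕ} [NeZero L] (ψ : QuarkIdx L → ℂ) (x : TorusSite 4 L)
    (S : Finset (Fin 4 → ℤ)) :
    boxMass ψ (S.image fun y => x + Torus.proj L y) ≤
      ∑ y ∈ S, ∑ a : Fin 3, ∑ α : Fin 4, ‖ψ (x + Torus.proj L y, a, α)‖ ^ 2 := by
  rw [ballSampling_boxMass_eq_sum]
  exact Finset.sum_image_le_of_nonneg fun _ _ =>
    Finset.sum_nonneg fun _ _ => Finset.sum_nonneg fun _ _ => by positivity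

/-- The squared norm of a pulled-back field on a finite `S ⊆ ℤ⁴` (indexed by the subtype, as in `ballNormSq`)
is the sum over preimages. -/
theorem ballSampling_sum_subtype_pullback {L : ℕ} (ψ : QuarkIdx L → ℂ) (x : TorusSite 4 L)
    (S : Finset (Fin 4 → ℤ)) :
    ∑ p : ↥S × Fin 3 × Fin 4, ‖ψ (x + Torus.proj L (p.1 : Fin 4 → ℤ), p.2.1, p.2.2)‖ ^ 2 =
      ∑ y ∈ S, ∑ a : Fin 3, ∑ α : Fin 4, ‖ψ (x + Torus.proj L y, a, α)‖ ^ 2 := by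
  rw [Fintype.sum_prod_type, ← Finset.sum_coe_sort S]
  simp only [Fintype.sum_prod_type]

/-! ### The pulled-back BALL field (gen 2b: `ballVal`, `ballApply`, `ballCurrent`, `ballNormSq`) -/

/-- **Sampling identity over the landed `ballApply`.**  For a ball field `φ` whose zero extension `ballVal φ`
agrees with the pull-back of `ψ` at `y` and its neighbours, `ballApply m₀ w φ y a α` with the links read around
`x`, `w = fun l => W (x + proj l.1, l.2)`, is `(Γ₅ D_W(W, m₀, 1) ψ)(x + proj y, a, α)`. -/
theorem ballSampling_ballApply_eq {R L : ℕ} [NeZero L] (x : TorusSite 4 L) (W : GaugeConfig 4 L SU3)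
    (m₀ : ℝ) (ψ : QuarkIdx L → ℂ) (φ : BallField R) (y : Fin 4 → ℤ) (a : Fin 3) (α : Fin 4)
    (h0 : ∀ γ, ballVal φ y a γ = ψ (x + Torus.proj L y, a, γ))
    (hp : ∀ μ b β, ballVal φ (y + Pi.single μ 1) b β = ψ (x + Torus.proj L (y + Pi.single μ 1), b, β))
    (hm : ∀ μ b β, ballVal φ (y - Pi.single μ 1) b β = ψ (x + Torus.proj L (y - Pi.single μ 1), b, β)) :
    ballApply m₀ (fun l => W (x + Torus.proj L l.1, l.2)) φ y a α =
      (spinorLift gammaFive * wilsonDirac (fundamentalRep (Fin 3)) W m₀ 1).mulVec ψ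
        (x + Torus.proj L y, a, α) := by
  rw [ballApply]
  exact ballSampling_latticeApply_eq x W m₀ ψ (ballVal φ) y a α h0 hp hm

/-- The zero extension of the literal pull-back ball field `p ↦ ψ(x + proj p.1, p.2)`. -/
theorem ballSampling_ballVal_pullback {R L : ℕ} (x : TorusSite 4 L) (ψ : QuarkIdx L → ℂ) (y : Fin 4 → ℤ)
    (a : Fin 3) (α : Fin 4) :
    ballVal (fun p : ↥(box 4 (R + 1)) × Fin 3 × Fin 4 => ψ (x + Torus.proj L (p.1 : Fin 4 → ℤ), p.2.1, p.2.2))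
        y a α =
      if y ∈ box 4 (R + 1) then ψ (x + Torus.proj L y, a, α) else 0 := by
  unfold ballVal
  split_ifs <;> rfl

/-- The zero extension of the pull-back ball field is a CUT-OFF PULL-BACK: at every site it is either the
pull-back `ψ(x + proj ·)` or `0`. -/
theorem ballSampling_ballVal_pullback_cutoff {R L : ℕ} (x : TorusSite 4 L) (ψ : QuarkIdx L → ℂ)
    (u : Fin 4 → ℤ) :
    (∀ a α, ballVal (fun p : ↥(box 4 (R + 1)) × Fin 3 × Fin 4 =>
        ψ (x + Torus.proj L (p.1 : Fin 4 → ℤ), p.2.1, p.2.2)) u a α = ψ (x + Torus.proj L u, a, α)) ∨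
      ∀ a α, ballVal (fun p : ↥(box 4 (R + 1)) × Fin 3 × Fin 4 =>
        ψ (x + Torus.proj L (p.1 : Fin 4 → ℤ), p.2.1, p.2.2)) u a α = 0 := by
  by_cases hu : u ∈ box 4 (R + 1)
  · exact Or.inl fun a α => by rw [ballSampling_ballVal_pullback, if_pos hu]
  · exact Or.inr fun a α => by rw [ballSampling_ballVal_pullback, if_neg hu]

/-- **Sampling identity for the pull-back ball field** at a site `y` with `y, y ± μ̂ ∈ box 4 (R+1)`. -/
theorem ballSampling_ballApply_pullback {R L : ℕ} [NeZero L] (x : TorusSite 4 L) (W : GaugeConfig 4 L SU3)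
    (m₀ : ℝ) (ψ : QuarkIdx L → ℂ) {y : Fin 4 → ℤ} (hy : y ∈ box 4 (R + 1))
    (hp : ∀ μ : Fin 4, y + Pi.single μ 1 ∈ box 4 (R + 1)) (hm : ∀ μ : Fin 4, y - Pi.single μ 1 ∈ box 4 (R + 1))
    (a : Fin 3) (α : Fin 4) :
    ballApply m₀ (fun l => W (x + Torus.proj L l.1, l.2))
        (fun p : ↥(box 4 (R + 1)) × Fin 3 × Fin 4 => ψ (x + Torus.proj L (p.1 : Fin 4 → ℤ), p.2.1, p.2.2))
        y a α =
      (spinorLift gammaFive * wilsonDirac (fundamentalRep (Fin 3)) W m₀ 1).mulVec ψ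
        (x + Torus.proj L y, a, α) :=
  ballSampling_ballApply_eq x W m₀ ψ _ y a α
    (fun γ => by rw [ballSampling_ballVal_pullback, if_pos hy])
    (fun μ b β => by rw [ballSampling_ballVal_pullback, if_pos (hp μ)])
    (fun μ b β => by rw [ballSampling_ballVal_pullback, if_pos (hm μ)])

/-- **Sampling identity for the pull-back ball field on the cube `box 4 R`** (whose neighbours lie in
`box 4 (R+1)`). -/
theorem ballSampling_ballApply_pullback_of_mem_box {R L : ℕ} [NeZero L] (x : TorusSite 4 L)
    (W : GaugeConfig 4 L SU3) (m₀ : ℝ) (ψ : QuarkIdx L → ℂ) {y : Fin 4 → ℤ} (hy : y ∈ box 4 R) (a : Fin 3)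
    (α : Fin 4) :
    ballApply m₀ (fun l => W (x + Torus.proj L l.1, l.2))
        (fun p : ↥(box 4 (R + 1)) × Fin 3 × Fin 4 => ψ (x + Torus.proj L (p.1 : Fin 4 → ℤ), p.2.1, p.2.2))
        y a α =
      (spinorLift gammaFive * wilsonDirac (fundamentalRep (Fin 3)) W m₀ 1).mulVec ψ
        (x + Torus.proj L y, a, α) :=
  ballSampling_ballApply_pullback x W m₀ ψ (box_mono 4 (Nat.le_succ R) hy)
    (fun μ => diracLocality_add_mem_box hy (diracLocality_single_mem_box μ))
    (fun μ => diracLocality_sub_mem_box hy (diracLocality_single_mem_box μ)) a α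

/-- **Zero cube residual of a pulled-back eigenvector.**  If `Γ₅ D_W(W, m₀, 1) ψ = λ ψ` on the torus, the
pull-back ball field solves the `ℤ⁴` eigen-equation exactly at every site of the cube `box 4 R`. -/
theorem ballSampling_residual_pullback_eq_zero {R L : ℕ} [NeZero L] (x : TorusSite 4 L)
    (W : GaugeConfig 4 L SU3) (m₀ lam : ℝ) (ψ : QuarkIdx L → ℂ)
    (hψ : (spinorLift gammaFive * wilsonDirac (fundamentalRep (Fin 3)) W m₀ 1).mulVec ψ = (lam : ℂ) • ψ)
    {y : Fin 4 → ℤ} (hy : y ∈ box 4 R) (a : Fin 3) (α : Fin 4) :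
    ballApply m₀ (fun l => W (x + Torus.proj L l.1, l.2))
          (fun p : ↥(box 4 (R + 1)) × Fin 3 × Fin 4 => ψ (x + Torus.proj L (p.1 : Fin 4 → ℤ), p.2.1, p.2.2))
          y a α -
        (lam : ℂ) * ballVal
          (fun p : ↥(box 4 (R + 1)) × Fin 3 × Fin 4 => ψ (x + Torus.proj L (p.1 : Fin 4 → ℤ), p.2.1, p.2.2))
          y a α = 0 := by
  rw [ballSampling_ballApply_pullback_of_mem_box x W m₀ ψ hy, hψ, ballSampling_ballVal_pullback,
    if_pos (box_mono 4 (Nat.le_succ R) hy), Pi.smul_apply, smul_eq_mul, sub_self]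


/-- **Current identity over the landed `ballCurrent`.**  For a ball field whose zero extension agrees with the
pull-back of `ψ` at `y` and `y + μ̂`, `ballCurrent w φ y μ i` (links read around `x`) is the torus current. -/
theorem ballSampling_ballCurrent_eq {R L : ℕ} (x : TorusSite 4 L) (W : GaugeConfig 4 L SU3)
    (ψ : QuarkIdx L → ℂ) (φ : BallField R) (y : Fin 4 → ℤ) (μ : Fin 4) (i : Fin 8)
    (h0 : ∀ a α, ballVal φ y a α = ψ (x + Torus.proj L y, a, α))
    (hp : ∀ b β, ballVal φ (y + Pi.single μ 1) b β = ψ (x + Torus.proj L (y + Pi.single μ 1), b, β)) :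
    ballCurrent (fun l => W (x + Torus.proj L l.1, l.2)) φ y μ i =
      2 * (∑ a : Fin 3, ∑ b : Fin 3, ∑ α : Fin 4, ∑ β : Fin 4,
        star (ψ (x + Torus.proj L y, a, α)) * fwdHop μ α β *
          (((W (x + Torus.proj L y, μ) : SU3) : Matrix (Fin 3) (Fin 3) ℂ) * su3Basis i) a b *
          ψ (Literature.MathematicalPhysics.QuantumFieldTheory.Site.shift (x + Torus.proj L y) μ, b, β)).re := by
  rw [ballCurrent]
  exact ballSampling_latticeCurrent_eq x W ψ (ballVal φ) y μ i h0 hp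

/-- Links leaving the ball carry no current: if `y + μ̂ ∉ box 4 (R+1)` then `ballCurrent w φ y μ i = 0`. -/
theorem ballSampling_ballCurrent_eq_zero {R : ℕ} (w : LinkData) (φ : BallField R) {y : Fin 4 → ℤ} {μ : Fin 4}
    (hy : y + Pi.single μ 1 ∉ box 4 (R + 1)) (i : Fin 8) : ballCurrent w φ y μ i = 0 := by
  rw [ballCurrent]
  refine ballSampling_latticeCurrent_eq_zero (ballVal φ y) (ballVal φ (y + Pi.single μ 1)) μ _ fun b β => ?_
  unfold ballVal
  rw [dif_neg hy]

/-- **Current identity for the pull-back ball field** at a link `(y, μ)` with `y, y + μ̂ ∈ box 4 (R+1)`. -/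
theorem ballSampling_ballCurrent_pullback {R L : ℕ} (x : TorusSite 4 L) (W : GaugeConfig 4 L SU3)
    (ψ : QuarkIdx L → ℂ) {y : Fin 4 → ℤ} {μ : Fin 4} (hy : y ∈ box 4 (R + 1))
    (hμ : y + Pi.single μ 1 ∈ box 4 (R + 1)) (i : Fin 8) :
    ballCurrent (fun l => W (x + Torus.proj L l.1, l.2))
        (fun p : ↥(box 4 (R + 1)) × Fin 3 × Fin 4 => ψ (x + Torus.proj L (p.1 : Fin 4 → ℤ), p.2.1, p.2.2))
        y μ i =
      2 * (∑ a : Fin 3, ∑ b : Fin 3, ∑ α : Fin 4, ∑ β : Fin 4,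
        star (ψ (x + Torus.proj L y, a, α)) * fwdHop μ α β *
          (((W (x + Torus.proj L y, μ) : SU3) : Matrix (Fin 3) (Fin 3) ℂ) * su3Basis i) a b *
          ψ (Literature.MathematicalPhysics.QuantumFieldTheory.Site.shift (x + Torus.proj L y) μ, b, β)).re :=
  ballSampling_ballCurrent_eq x W ψ _ y μ i
    (fun a α => by rw [ballSampling_ballVal_pullback, if_pos hy])
    (fun b β => by rw [ballSampling_ballVal_pullback, if_pos hμ])

/-- **Term-by-term current domination for the pull-back ball field.**  For EVERY link `(y, μ)` of `ℤ⁴` and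
direction `X_i`, `|ballCurrent w φ y μ i| ≤ |J_{(x + proj y, μ), X_i}(ψ)|`: equality when `y, y + μ̂` are in the
ball, and the left side is `0` otherwise. -/
theorem ballSampling_abs_ballCurrent_pullback_le {R L : ℕ} (x : TorusSite 4 L) (W : GaugeConfig 4 L SU3)
    (ψ : QuarkIdx L → ℂ) (y : Fin 4 → ℤ) (μ : Fin 4) (i : Fin 8) :
    |ballCurrent (fun l => W (x + Torus.proj L l.1, l.2))
        (fun p : ↥(box 4 (R + 1)) × Fin 3 × Fin 4 => ψ (x + Torus.proj L (p.1 : Fin 4 → ℤ), p.2.1, p.2.2))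
        y μ i| ≤
      |2 * (∑ a : Fin 3, ∑ b : Fin 3, ∑ α : Fin 4, ∑ β : Fin 4,
        star (ψ (x + Torus.proj L y, a, α)) * fwdHop μ α β *
          (((W (x + Torus.proj L y, μ) : SU3) : Matrix (Fin 3) (Fin 3) ℂ) * su3Basis i) a b *
          ψ (Literature.MathematicalPhysics.QuantumFieldTheory.Site.shift (x + Torus.proj L y) μ, b, β)).re| := by
  rw [ballCurrent]
  exact ballSampling_abs_latticeCurrent_le x W ψ _ (ballSampling_ballVal_pullback_cutoff x ψ) y μ i


/-- `ballNormSq` of the pull-back ball field is the sum over the preimage box `box 4 (R+1)`. -/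
theorem ballSampling_ballNormSq_pullback {R L : ℕ} (ψ : QuarkIdx L → ℂ) (x : TorusSite 4 L) :
    ballNormSq R
        (fun p : ↥(box 4 (R + 1)) × Fin 3 × Fin 4 => ψ (x + Torus.proj L (p.1 : Fin 4 → ℤ), p.2.1, p.2.2)) =
      ∑ y ∈ box 4 (R + 1), ∑ a : Fin 3, ∑ α : Fin 4, ‖ψ (x + Torus.proj L y, a, α)‖ ^ 2 := by
  rw [ballNormSq]
  exact ballSampling_sum_subtype_pullback ψ x (box 4 (R + 1))

/-- **Local mass on a sub-cube is at most the pull-back norm**: for `R' ≤ R + 1`,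
`boxMass ψ {x + proj y : y ∈ box 4 R'} ≤ ballNormSq R (pull-back of ψ)`. -/
theorem ballSampling_boxMass_le_ballNormSq {R R' L : ℕ} [NeZero L] (hR : R' ≤ R + 1) (ψ : QuarkIdx L → ℂ)
    (x : TorusSite 4 L) :
    boxMass ψ ((box 4 R').image fun y => x + Torus.proj L y) ≤
      ballNormSq R
        (fun p : ↥(box 4 (R + 1)) × Fin 3 × Fin 4 => ψ (x + Torus.proj L (p.1 : Fin 4 → ℤ), p.2.1, p.2.2)) := by
  rw [ballSampling_ballNormSq_pullback]
  exact (ballSampling_boxMass_image_le ψ x (box 4 R')).trans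
    (Finset.sum_le_sum_of_subset_of_nonneg (box_mono 4 hR) fun _ _ _ =>
      Finset.sum_nonneg fun _ _ => Finset.sum_nonneg fun _ _ => by positivity)


/-! ### The pulled-back PORT field (gen 2c: `portVal`, `latticeApply`, `latticeCurrent`, `portNormSq`) -/

/-- The zero extension of the literal pull-back port field `p ↦ ψ(x + proj p.1, p.2)`. -/
theorem ballSampling_portVal_pullback {R L : ℕ} (x : TorusSite 4 L) (ψ : QuarkIdx L → ℂ) (y : Fin 4 → ℤ)
    (a : Fin 3) (α : Fin 4) :
    portVal (fun p : ↥(portDomain R) × Fin 3 × Fin 4 => ψ (x + Torus.proj L (p.1 : Fin 4 → ℤ), p.2.1, p.2.2))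
        y a α =
      if y ∈ portDomain R then ψ (x + Torus.proj L y, a, α) else 0 := by
  unfold portVal
  split_ifs <;> rfl

/-- The zero extension of the pull-back port field is a cut-off pull-back. -/
theorem ballSampling_portVal_pullback_cutoff {R L : ℕ} (x : TorusSite 4 L) (ψ : QuarkIdx L → ℂ)
    (u : Fin 4 → ℤ) :
    (∀ a α, portVal (fun p : ↥(portDomain R) × Fin 3 × Fin 4 =>
        ψ (x + Torus.proj L (p.1 : Fin 4 → ℤ), p.2.1, p.2.2)) u a α = ψ (x + Torus.proj L u, a, α)) ∨
      ∀ a α, portVal (fun p : ↥(portDomain R) × Fin 3 × Fin 4 =>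
        ψ (x + Torus.proj L (p.1 : Fin 4 → ℤ), p.2.1, p.2.2)) u a α = 0 := by
  by_cases hu : u ∈ portDomain R
  · exact Or.inl fun a α => by rw [ballSampling_portVal_pullback, if_pos hu]
  · exact Or.inr fun a α => by rw [ballSampling_portVal_pullback, if_neg hu]

/-- For `R = 0` the port domain is empty (the one site of `box 4 0` has four extreme coordinates). -/
theorem ballSampling_not_mem_portDomain_zero (y : Fin 4 → ℤ) : y ∉ portDomain 0 := by
  intro hy
  rw [portDomain, Finset.mem_filter, mem_box] at hy
  obtain ⟨hb, hc⟩ := hy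
  have h0 : ∀ μ, y μ = 0 := fun μ => by have h := hb μ; push_cast at h; omega
  have h4 : extremeCount 0 y = 4 := by
    rw [extremeCount, Finset.filter_true_of_mem, Finset.card_univ, Fintype.card_fin]
    exact fun μ _ => by rw [h0 μ]; simp
  omega

/-- A site with all coordinates but possibly the `μ`-th of absolute value `< R` has at most one extreme
coordinate. -/
theorem ballSampling_extremeCount_le_one {R : ℕ} {u : Fin 4 → ℤ} (μ : Fin 4)
    (hu : ∀ ν, ν ≠ μ → |u ν| < (R : ℤ)) : extremeCount R u ≤ 1 := by
  rw [extremeCount]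
  calc (Finset.univ.filter fun ν : Fin 4 => |u ν| = (R : ℤ)).card ≤ ({μ} : Finset (Fin 4)).card :=
        Finset.card_le_card fun ν hν => ?_
    _ = 1 := Finset.card_singleton μ
  rw [Finset.mem_singleton]
  by_contra hne
  have h := (Finset.mem_filter.1 hν).2
  have h' := hu ν hne
  omega

/-- For `R ≥ 1` the interior cube `box 4 (R − 1)` lies in the port domain. -/
theorem ballSampling_mem_portDomain_of_mem_box {R : ℕ} (hR : 1 ≤ R) {y : Fin 4 → ℤ} (hy : y ∈ box 4 (R - 1)) :
    y ∈ portDomain R := by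
  obtain ⟨R, rfl⟩ : ∃ R', R = R' + 1 := ⟨R - 1, (Nat.sub_add_cancel hR).symm⟩
  rw [Nat.add_sub_cancel] at hy
  rw [portDomain, Finset.mem_filter]
  refine ⟨box_mono 4 (Nat.le_succ R) hy, (ballSampling_extremeCount_le_one 0 fun ν _ => ?_).trans (by norm_num)⟩
  have h := (mem_box.1 hy) ν
  rw [abs_lt]
  push_cast
  constructor <;> omega

/-- For `R ≥ 1` the forward neighbours of the interior cube lie in the port domain. -/
theorem ballSampling_add_single_mem_portDomain {R : ℕ} (hR : 1 ≤ R) {y : Fin 4 → ℤ} (hy : y ∈ box 4 (R - 1))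
    (μ : Fin 4) : y + Pi.single μ 1 ∈ portDomain R := by
  obtain ⟨R, rfl⟩ : ∃ R', R = R' + 1 := ⟨R - 1, (Nat.sub_add_cancel hR).symm⟩
  rw [Nat.add_sub_cancel] at hy
  rw [portDomain, Finset.mem_filter]
  refine ⟨diracLocality_add_mem_box hy (diracLocality_single_mem_box μ),
    (ballSampling_extremeCount_le_one μ fun ν hν => ?_).trans (by norm_num)⟩
  have h := (mem_box.1 hy) ν
  rw [Pi.add_apply, Pi.single_eq_of_ne hν, add_zero, abs_lt]
  push_cast
  constructor <;> omega

/-- For `R ≥ 1` the backward neighbours of the interior cube lie in the port domain. -/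
theorem ballSampling_sub_single_mem_portDomain {R : ℕ} (hR : 1 ≤ R) {y : Fin 4 → ℤ} (hy : y ∈ box 4 (R - 1))
    (μ : Fin 4) : y - Pi.single μ 1 ∈ portDomain R := by
  obtain ⟨R, rfl⟩ : ∃ R', R = R' + 1 := ⟨R - 1, (Nat.sub_add_cancel hR).symm⟩
  rw [Nat.add_sub_cancel] at hy
  rw [portDomain, Finset.mem_filter]
  refine ⟨diracLocality_sub_mem_box hy (diracLocality_single_mem_box μ),
    (ballSampling_extremeCount_le_one μ fun ν hν => ?_).trans (by norm_num)⟩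
  have h := (mem_box.1 hy) ν
  rw [Pi.sub_apply, Pi.single_eq_of_ne hν, sub_zero, abs_lt]
  push_cast
  constructor <;> omega

/-- **Sampling identity for the pull-back port field on the interior cube** (`R ≥ 1`, `y ∈ box 4 (R − 1)`):
`latticeApply m₀ w (portVal φ) y a α = (Γ₅ D_W(W, m₀, 1) ψ)(x + proj y, a, α)`, every torus `L ≥ 1`. -/
theorem ballSampling_latticeApply_portVal_pullback {R L : ℕ} [NeZero L] (hR : 1 ≤ R) (x : TorusSite 4 L)
    (W : GaugeConfig 4 L SU3) (m₀ : ℝ) (ψ : QuarkIdx L → ℂ) {y : Fin 4 → ℤ} (hy : y ∈ box 4 (R - 1))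
    (a : Fin 3) (α : Fin 4) :
    latticeApply m₀ (fun l => W (x + Torus.proj L l.1, l.2))
        (portVal fun p : ↥(portDomain R) × Fin 3 × Fin 4 => ψ (x + Torus.proj L (p.1 : Fin 4 → ℤ), p.2.1, p.2.2))
        y a α =
      (spinorLift gammaFive * wilsonDirac (fundamentalRep (Fin 3)) W m₀ 1).mulVec ψ
        (x + Torus.proj L y, a, α) :=
  ballSampling_latticeApply_read_eq x W m₀ ψ _ y a α
    (fun γ => by rw [ballSampling_portVal_pullback, if_pos (ballSampling_mem_portDomain_of_mem_box hR hy)])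
    (fun μ b β => by
      rw [ballSampling_portVal_pullback, if_pos (ballSampling_add_single_mem_portDomain hR hy μ)])
    (fun μ b β => by
      rw [ballSampling_portVal_pullback, if_pos (ballSampling_sub_single_mem_portDomain hR hy μ)])

/-- **Zero interior residual of a pulled-back eigenvector** (every `R`; links read around `x` from ANY
configuration `W`, in particular the glued one): if `Γ₅ D_W(W, m₀, 1) ψ = λ ψ` on the torus then
`portInteriorResSq R m₀ λ w (pull-back port field) = 0`. -/
theorem ballSampling_portInteriorResSq_pullback_eq_zero {R L : ℕ} [NeZero L] (x : TorusSite 4 L)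
    (W : GaugeConfig 4 L SU3) (m₀ lam : ℝ) (ψ : QuarkIdx L → ℂ)
    (hψ : (spinorLift gammaFive * wilsonDirac (fundamentalRep (Fin 3)) W m₀ 1).mulVec ψ = (lam : ℂ) • ψ) :
    portInteriorResSq R m₀ lam (fun l => W (x + Torus.proj L l.1, l.2))
        (fun p : ↥(portDomain R) × Fin 3 × Fin 4 => ψ (x + Torus.proj L (p.1 : Fin 4 → ℤ), p.2.1, p.2.2)) =
      0 := by
  refine Finset.sum_eq_zero fun y hy => Finset.sum_eq_zero fun a _ => Finset.sum_eq_zero fun α _ => ?_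
  rcases Nat.eq_zero_or_pos R with rfl | hR
  · -- `R = 0`: the port domain is empty, every value read by `latticeApply` is `0`
    have h0 : ∀ u b β, portVal (fun p : ↥(portDomain 0) × Fin 3 × Fin 4 =>
        ψ (x + Torus.proj L (p.1 : Fin 4 → ℤ), p.2.1, p.2.2)) u b β = 0 := fun u b β => by
      rw [ballSampling_portVal_pullback, if_neg (ballSampling_not_mem_portDomain_zero u)]
    simp [latticeApply, h0]
  · rw [ballSampling_latticeApply_portVal_pullback hR x W m₀ ψ hy, hψ, ballSampling_portVal_pullback,
      if_pos (ballSampling_mem_portDomain_of_mem_box hR hy), Pi.smul_apply, smul_eq_mul, sub_self, norm_zero,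
      zero_pow two_ne_zero]

/-- **Cube current sum of the pulled-back port field versus the registered right-hand side** (glued links,
VERBATIM the right-hand side of `stub_currentRigidity` / `stub_portRigidity`). -/
theorem ballSampling_portCurrentSum_pullback_le_verbatim (R : ℕ) {L : ℕ} (x : TorusSite 4 L)
    (U V : GaugeConfig 4 L SU3) (ψ : QuarkIdx L → ℂ) :
    portCurrentSum R
        (fun l => (fun e : Edge 4 L => if (∃ y ∈ box 4 R, e.1 = x + Torus.proj L y) then V e else U e)
          (x + Torus.proj L l.1, l.2))
        (fun p : ↥(portDomain R) × Fin 3 × Fin 4 => ψ (x + Torus.proj L (p.1 : Fin 4 → ℤ), p.2.1, p.2.2)) ≤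
      ∑ y ∈ box 4 R, ∑ μ : Fin 4, ∑ i : Fin 8,
              |2 * (∑ a : Fin 3, ∑ b : Fin 3, ∑ α : Fin 4, ∑ β : Fin 4,
                  star (ψ (x + Torus.proj L y, a, α)) *
                    (gammaFive * ((-(1 / 2 : ℂ)) • ((1 : Matrix (Fin 4) (Fin 4) ℂ) - euclideanGamma μ))) α β *
                    ((((fun e : Edge 4 L => if (∃ y ∈ box 4 R, e.1 = x + Torus.proj L y) then V e else U e)
                          (x + Torus.proj L y, μ) : SU3) : Matrix (Fin 3) (Fin 3) ℂ) *
                        (![!![0, 1, 0; -1, 0, 0; 0, 0, 0], !![0, 0, 1; 0, 0, 0; -1, 0, 0],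
                           !![0, 0, 0; 0, 0, 1; 0, -1, 0], !![0, Complex.I, 0; Complex.I, 0, 0; 0, 0, 0],
                           !![0, 0, Complex.I; 0, 0, 0; Complex.I, 0, 0],
                           !![0, 0, 0; 0, 0, Complex.I; 0, Complex.I, 0],
                           !![Complex.I, 0, 0; 0, -Complex.I, 0; 0, 0, 0],
                           !![0, 0, 0; 0, Complex.I, 0; 0, 0, -Complex.I]] i : Matrix (Fin 3) (Fin 3) ℂ)) a b *
                    ψ (Literature.MathematicalPhysics.QuantumFieldTheory.Site.shift (x + Torus.proj L y) μ,
                      b, β)).re| := by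
  rw [portCurrentSum]
  exact ballSampling_cubeCurrent_le_verbatim R x U V ψ _ (ballSampling_portVal_pullback_cutoff x ψ)

/-- `portNormSq` of the pull-back port field is the sum over the preimage set `portDomain R`. -/
theorem ballSampling_portNormSq_pullback {R L : ℕ} (ψ : QuarkIdx L → ℂ) (x : TorusSite 4 L) :
    portNormSq R
        (fun p : ↥(portDomain R) × Fin 3 × Fin 4 => ψ (x + Torus.proj L (p.1 : Fin 4 → ℤ), p.2.1, p.2.2)) =
      ∑ y ∈ portDomain R, ∑ a : Fin 3, ∑ α : Fin 4, ‖ψ (x + Torus.proj L y, a, α)‖ ^ 2 := by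
  rw [portNormSq]
  exact ballSampling_sum_subtype_pullback ψ x (portDomain R)

/-- **Local mass on the interior cube is at most the port norm** (`R ≥ 1`):
`boxMass ψ {x + proj y : y ∈ box 4 (R − 1)} ≤ portNormSq R (pull-back port field)`. -/
theorem ballSampling_boxMass_le_portNormSq {R L : ℕ} [NeZero L] (hR : 1 ≤ R) (ψ : QuarkIdx L → ℂ)
    (x : TorusSite 4 L) :
    boxMass ψ ((box 4 (R - 1)).image fun y => x + Torus.proj L y) ≤
      portNormSq R
        (fun p : ↥(portDomain R) × Fin 3 × Fin 4 => ψ (x + Torus.proj L (p.1 : Fin 4 → ℤ), p.2.1, p.2.2)) := by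
  rw [ballSampling_portNormSq_pullback]
  exact (ballSampling_boxMass_image_le ψ x (box 4 (R - 1))).trans
    (Finset.sum_le_sum_of_subset_of_nonneg (fun y hy => ballSampling_mem_portDomain_of_mem_box hR hy)
      fun _ _ _ => Finset.sum_nonneg fun _ _ => Finset.sum_nonneg fun _ _ => by positivity)

end Summit.QuantumFields.QCD.Cruxes.WegnerEstimate.ResolventCell

end
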